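import Mathlib
import Literature.NumberTheory.LFunctions.WeilExplicit
import Literature.NumberTheory.LFunctions.WeilSmallSupportPositivity
import Literature.NumberTheory.LFunctions.WeilGroundState
import Summits.RiemannHypothesis.RiemannHypothesis.Theses.WeilWindowFlow

/-!
# `DiniGlue` for route WeilWindowFlow (item stmt-RiemannHypothesis-1044)

**What is proved.** The route decl
`Summit.RiemannHypothesis.RiemannHypothesis.Theses.WeilWindowFlow.DiniGlue`, i.e.
`DiniLeakage → WindowContinuity → GronwallLeakage`: from the lower-right Dini leakage bound
`ε(a) − ε(a+h) ≤ h (K ε(a) + η)` (for arbitrarily small `h > 0`, `K` uniform on compact window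
ranges) and continuity of the window bottom `ε = weilGroundEnergy` on `(0, ∞)`, there is ONE rate
`C`, interval-integrable on every `[b, a] ⊂ (0, ∞)`, with `ε(b) · exp(−∫_b^a C) ≤ ε(a)`.

**Proof.**
1. *Dini fence with variable rate* (`dini_fence`): if `f` is continuous on `[b, a] ⊂ (0, ∞)`,
   `f b > 0`, `C` is continuous on `(0, ∞)`, and at every `x ∈ [b, a)` the lower right Dini
   derivative of `−f` is `≤ k(x) f(x)` with `k ≤ C`, then `f b · exp(−∫_b^a C) ≤ f a`. This is
   Mathlib's fencing theorem `image_le_of_liminf_slope_right_lt_deriv_boundary'` applied to `−f`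
   with the barrier `B(x) = −f(b) · exp(−∫_b^x C − e (x − b))`, `e > 0`, followed by `e → 0⁺`.
2. *Anchor*: `ε(a) ≥ 1` for all small `a > 0` (`weilQuadratic_coercive 1`, Bombieri 2000 Thm 12,
   plus non-emptiness of the unit sphere `exists_isWeilTest_sphere`), hence, by the constant-rate
   fence, `ε > 0` on all of `(0, ∞)` under the two hypotheses.
3. *One rate*: let `K n` be the Dini constant of the range `[1/(n+1), n+1]`,
   `s n = ∑_{i ≤ n} |K i|` (monotone, `≥ K n`), `g = s ∘ ⌊·⌋₊` (a monotone step function),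
   `φ(y) = ∫_0^{y+2} g` (continuous, `φ(y) ≥ s ⌈y⌉₊` for `y ≥ 0`) and `C(x) = φ(x) + φ(x⁻¹)`.
   Then `C` is continuous on `(0, ∞)` and dominates the valid Dini constant `s ⌈max x x⁻¹⌉₊` at
   every `x > 0`, so step 1 applies on every `[b, a]` at once.

No named facts are assumed; axioms ⊆ {propext, Classical.choice, Quot.sound}.
-/

-- `Summit.RiemannHypothesis.RiemannHypothesis.…` repeats a namespace component by design (D-0017).
set_option linter.dupNamespace false

noncomputable section

open MeasureTheory Set Filter intervalIntegral
open scoped Topology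

namespace Summit.RiemannHypothesis.RiemannHypothesis.Theorems.WeilWindowFlowDiniGlue

open Literature.NumberTheory.LFunctions
open Summit.RiemannHypothesis.RiemannHypothesis.Theses.WeilWindowFlow

/-! ## 1. The Dini fence with a variable, continuous rate -/

/-- **Dini fence (variable rate).** Let `f` be continuous on `[b, a]` with `0 < b ≤ a` and
`f b > 0`, let `C` be continuous on `(0, ∞)` and `k ≤ C` on `[b, a)`, and suppose that at every
`x ∈ [b, a)` and for all `η, δ > 0` there is `h ∈ (0, δ)` with `f x − f (x + h) ≤ h (k x · f x + η)`
(the lower right Dini derivative of `−f` at `x` is at most `k x · f x`). Then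
`f b · exp (−∫_b^a C) ≤ f a`. [folklore] -/
theorem dini_fence {f k C : ℝ → ℝ} {b a : ℝ} (hb : 0 < b) (hba : b ≤ a)
    (hf : ContinuousOn f (Icc b a)) (hfb : 0 < f b)
    (hC : ContinuousOn C (Ioi 0)) (hkC : ∀ x ∈ Ico b a, k x ≤ C x)
    (hD : ∀ x ∈ Ico b a, ∀ η δ : ℝ, 0 < η → 0 < δ →
      ∃ h : ℝ, 0 < h ∧ h < δ ∧ f x - f (x + h) ≤ h * (k x * f x + η)) :
    f b * Real.exp (-(∫ x in b..a, C x)) ≤ f a := by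
  set Φ : ℝ → ℝ := fun x ↦ ∫ t in b..x, C t with hΦ
  -- `Φ' = C` on `(0, ∞)` (FTC-1 at points of continuity)
  have hΦd : ∀ x, 0 < x → HasDerivAt Φ (C x) x := by
    intro x hx
    apply intervalIntegral.integral_hasDerivAt_right
    · refine (hC.mono ?_).intervalIntegrable
      intro t ht
      exact lt_of_lt_of_le (lt_min hb hx) ht.1
    · exact hC.stronglyMeasurableAtFilter isOpen_Ioi x hx
    · exact hC.continuousAt (Ioi_mem_nhds hx)
  -- the liminf-slope form of the Dini hypothesis for `-f`
  have hf' : ∀ x ∈ Ico b a, ∀ r, k x * f x < r →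
      ∃ᶠ z in 𝓝[>] x, slope (fun y ↦ -f y) x z < r := by
    intro x hx r hr
    rw [Filter.frequently_iff]
    intro U hU
    obtain ⟨u, hu, hUsub⟩ := mem_nhdsGT_iff_exists_Ioo_subset.1 hU
    have hu' : 0 < u - x := sub_pos.2 hu
    obtain ⟨h, hh0, hhu, hle⟩ := hD x hx ((r - k x * f x) / 2) (u - x) (by linarith) hu'
    refine ⟨x + h, hUsub ⟨by linarith, by linarith⟩, ?_⟩
    rw [slope_def_field]
    have h1 : (-f (x + h) - -f x) / (x + h - x) = (f x - f (x + h)) / h := by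
      rw [show x + h - x = h by ring]
      ring
    rw [h1, div_lt_iff₀ hh0]
    have h2 : k x * f x + (r - k x * f x) / 2 < r := by linarith
    have h3 := mul_lt_mul_of_pos_left h2 hh0
    linarith
  -- for every `e > 0`, the barrier `-f b · exp (-Φ x - e (x - b))` fences `-f` from above
  have key : ∀ e : ℝ, 0 < e → f b * Real.exp (-(Φ a) - e * (a - b)) ≤ f a := by
    intro e he
    set B : ℝ → ℝ := fun x ↦ -(f b) * Real.exp (-(Φ x) - e * (x - b)) with hB
    set B' : ℝ → ℝ := fun x ↦ -(f b) * (Real.exp (-(Φ x) - e * (x - b)) * (-(C x) - e))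
      with hB'
    have hBd : ∀ x, 0 < x → HasDerivAt B (B' x) x := by
      intro x hx
      have h1 : HasDerivAt (fun y ↦ -(Φ y) - e * (y - b)) (-(C x) - e) x := by
        have h2 : HasDerivAt (fun y ↦ e * (y - b)) e x := by
          simpa using ((hasDerivAt_id x).sub_const b).const_mul e
        exact (hΦd x hx).neg.sub h2
      exact h1.exp.const_mul (-(f b))
    have result := image_le_of_liminf_slope_right_lt_deriv_boundary' (f := fun y ↦ -f y)
      (f' := fun x ↦ k x * f x) (a := b) (b := a) hf.neg hf' (B := B) (B' := B') ?_ ?_ ?_ ?_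
      (x := a) ⟨hba, le_rfl⟩
    · simp only [hB] at result
      linarith
    · simp [hB, hΦ]
    · exact fun x hx ↦ (hBd x (lt_of_lt_of_le hb hx.1)).continuousAt.continuousWithinAt
    · exact fun x hx ↦ (hBd x (lt_of_lt_of_le hb hx.1)).hasDerivWithinAt
    · intro x hx hfx
      have hE : 0 < Real.exp (-(Φ x) - e * (x - b)) := Real.exp_pos _
      have hfxE : f x = f b * Real.exp (-(Φ x) - e * (x - b)) := by
        simp only [hB] at hfx
        linarith
      have hfxpos : 0 < f x := hfxE ▸ mul_pos hfb hE
      have hk := hkC x hx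
      have h3 : B' x = f x * (C x + e) := by rw [hfxE, hB']; ring
      rw [h3]
      have h4 := mul_lt_mul_of_pos_left (show k x < C x + e by linarith) hfxpos
      linarith
  -- let `e → 0⁺`
  have ht : Tendsto (fun e ↦ f b * Real.exp (-(Φ a) - e * (a - b))) (𝓝[>] 0)
      (𝓝 (f b * Real.exp (-(Φ a)))) := by
    have hc : Continuous (fun e : ℝ ↦ f b * Real.exp (-(Φ a) - e * (a - b))) := by fun_prop
    have h0 := hc.tendsto 0
    simp only [zero_mul, sub_zero] at h0
    exact h0.mono_left nhdsWithin_le_nhds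
  exact le_of_tendsto ht (eventually_nhdsWithin_of_forall key)

/-! ## 2. The coercive anchor and positivity of the bottom -/

/-- **Anchor.** There is `a₀ > 0` with `1 ≤ ε(a)` for all `0 < a ≤ a₀` (coercivity of Weil's form for
small support, `weilQuadratic_coercive 1`, Bombieri 2000 Thm 12; the unit sphere of every window
`a > 0` is nonempty). [cite: Bombieri2000Weil, Thm 12] -/
theorem exists_one_le_weilGroundEnergy :
    ∃ a₀ : ℝ, 0 < a₀ ∧ ∀ a : ℝ, 0 < a → a ≤ a₀ → 1 ≤ weilGroundEnergy a := by
  obtain ⟨a₀, ha₀, h⟩ := weilQuadratic_coercive 1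
  refine ⟨a₀, ha₀, fun a ha hle ↦ ?_⟩
  obtain ⟨g₀, hg₀, hs₀, hn₀⟩ := exists_isWeilTest_sphere ha
  unfold weilGroundEnergy
  refine le_csInf ⟨(weilQuadratic g₀).re, g₀, hg₀, hs₀, hn₀, rfl⟩ ?_
  rintro x ⟨g, hg, hs, hn, rfl⟩
  have h1 := h a ha hle g hg hs
  rw [hn, mul_one] at h1
  exact h1

/-- **No conjugate point.** Under `DiniLeakage` and `WindowContinuity` the window bottom is strictly
positive at every window: `0 < ε(x)` for all `x > 0` (anchor `ε ≥ 1` near `0⁺`, then the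
constant-rate Dini fence on `[min a₀ x, x]`). [folklore] -/
theorem weilGroundEnergy_pos_of_diniLeakage (hD : DiniLeakage) (hW : WindowContinuity) {x : ℝ}
    (hx : 0 < x) : 0 < weilGroundEnergy x := by
  obtain ⟨a₀, ha₀, h1⟩ := exists_one_le_weilGroundEnergy
  set b := min a₀ x with hbdef
  have hb : 0 < b := lt_min ha₀ hx
  have hbx : b ≤ x := min_le_right _ _
  have hb1 : 1 ≤ weilGroundEnergy b := h1 b hb (min_le_left _ _)
  obtain ⟨K, hK⟩ := hD b x hb hbx
  have hcont : ContinuousOn weilGroundEnergy (Icc b x) :=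
    fun y hy ↦ (hW y (lt_of_lt_of_le hb hy.1)).continuousWithinAt
  have h2 := dini_fence (k := fun _ ↦ K) (C := fun _ ↦ K) hb hbx hcont (by linarith)
    continuousOn_const (fun _ _ ↦ le_rfl) (fun y hy η δ hη hδ ↦ hK y hy.1 hy.2.le η δ hη hδ)
  exact lt_of_lt_of_le (mul_pos (by linarith) (Real.exp_pos _)) h2

/-! ## 3. One locally integrable rate: the glue -/

/-- **DiniGlue** (item stmt-RiemannHypothesis-1044 of route WeilWindowFlow):
`DiniLeakage → WindowContinuity → GronwallLeakage`. The rate is `C(x) = φ(x) + φ(x⁻¹)` with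
`φ(y) = ∫_0^{y+2} s ⌊t⌋₊ dt`, `s n = ∑_{i ≤ n} |K i|`, `K n` the Dini constant of the window range
`[1/(n+1), n+1]`; `C` is continuous on `(0, ∞)` and dominates a valid Dini constant at every
point, so the variable-rate fence `dini_fence` gives `ε(b) exp(−∫_b^a C) ≤ ε(a)` for all
`0 < b ≤ a` (positivity of `ε(b)` from `weilGroundEnergy_pos_of_diniLeakage`). [folklore] -/
theorem diniGlue_proof : DiniGlue := by
  unfold DiniGlue
  intro hD hW
  -- Dini constants on the ranges `[1/(n+1), n+1]`
  have hKex : ∀ n : ℕ, ∃ K : ℝ, ∀ a : ℝ, 1 / ((n : ℝ) + 1) ≤ a → a ≤ n + 1 → ∀ η δ : ℝ,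
      0 < η → 0 < δ → ∃ h : ℝ, 0 < h ∧ h < δ ∧
        weilGroundEnergy a - weilGroundEnergy (a + h) ≤ h * (K * weilGroundEnergy a + η) := by
    intro n
    have hn : (0 : ℝ) < n + 1 := by positivity
    refine hD _ _ (by positivity) ?_
    rw [div_le_iff₀ hn]
    nlinarith
  choose K hK using hKex
  -- monotone nonnegative envelope of `|K|`
  set s : ℕ → ℝ := fun n ↦ ∑ i ∈ Finset.range (n + 1), |K i| with hs
  have hs_nonneg : ∀ n, 0 ≤ s n := fun n ↦ Finset.sum_nonneg fun i _ ↦ abs_nonneg _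
  have hs_mono : Monotone s := by
    intro m n hmn
    exact Finset.sum_le_sum_of_subset_of_nonneg (Finset.range_mono (by omega))
      fun i _ _ ↦ abs_nonneg _
  have hKs : ∀ n, K n ≤ s n := fun n ↦ (le_abs_self _).trans
    (Finset.single_le_sum (f := fun i ↦ |K i|) (fun i _ ↦ abs_nonneg _)
      (Finset.mem_range.2 (Nat.lt_succ_self n)))
  -- the monotone step function `g` and its continuous primitive `φ`
  set g : ℝ → ℝ := fun t ↦ s ⌊t⌋₊ with hg
  have hg_mono : Monotone g := fun x y hxy ↦ hs_mono (Nat.floor_le_floor hxy)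
  have hg_nonneg : ∀ t, 0 ≤ g t := fun t ↦ hs_nonneg _
  have hgi : ∀ u v : ℝ, IntervalIntegrable g volume u v := fun u v ↦ hg_mono.intervalIntegrable
  set φ : ℝ → ℝ := fun y ↦ ∫ t in (0 : ℝ)..(y + 2), g t with hφ
  have hφ_cont : Continuous φ :=
    (intervalIntegral.continuous_primitive hgi 0).comp (continuous_id.add continuous_const)
  have hφ_nonneg : ∀ y, 0 ≤ y → 0 ≤ φ y :=
    fun y hy ↦ intervalIntegral.integral_nonneg (by linarith) fun t _ ↦ hg_nonneg t
  have hφ_ge : ∀ y, 0 ≤ y → s ⌈y⌉₊ ≤ φ y := by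
    intro y hy
    have h1 : s ⌈y⌉₊ ≤ g (y + 1) := by
      show s ⌈y⌉₊ ≤ s ⌊y + 1⌋₊
      rw [Nat.floor_add_one hy]
      exact hs_mono (Nat.ceil_le_floor_add_one y)
    have h2 : g (y + 1) ≤ ∫ t in (y + 1)..(y + 2), g t := by
      have h3 := intervalIntegral.integral_mono_on (by linarith : y + 1 ≤ y + 2)
        intervalIntegrable_const (hgi _ _) (fun t ht ↦ hg_mono ht.1)
      rw [intervalIntegral.integral_const, smul_eq_mul] at h3
      have h5 : (y + 2 - (y + 1)) * g (y + 1) = g (y + 1) := by ring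
      linarith
    have h3 : 0 ≤ ∫ t in (0 : ℝ)..(y + 1), g t :=
      intervalIntegral.integral_nonneg (by linarith) fun t _ ↦ hg_nonneg t
    have h4 : φ y = (∫ t in (0 : ℝ)..(y + 1), g t) + ∫ t in (y + 1)..(y + 2), g t :=
      (intervalIntegral.integral_add_adjacent_intervals (hgi _ _) (hgi _ _)).symm
    linarith
  -- the rate
  set C : ℝ → ℝ := fun x ↦ φ x + φ x⁻¹ with hC
  have hC_cont : ContinuousOn C (Ioi 0) := by
    refine hφ_cont.continuousOn.add (hφ_cont.comp_continuousOn (continuousOn_inv₀.mono ?_))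
    intro x hx
    exact ne_of_gt hx
  -- the valid Dini constant at `x` is `s (N x)`, `N x = ⌈max x x⁻¹⌉₊`
  set N : ℝ → ℕ := fun x ↦ ⌈max x x⁻¹⌉₊ with hN
  have hNge : ∀ x, max x x⁻¹ ≤ N x := fun x ↦ Nat.le_ceil _
  have hN2 : ∀ x, 0 < x → x ≤ N x + 1 := fun x _ ↦ by
    linarith [le_max_left x x⁻¹, hNge x]
  have hN1 : ∀ x, 0 < x → 1 / ((N x : ℝ) + 1) ≤ x := by
    intro x hx
    have h1 : x⁻¹ ≤ N x + 1 := by linarith [le_max_right x x⁻¹, hNge x]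
    have h2 := one_div_le_one_div_of_le (inv_pos.2 hx) h1
    simpa using h2
  have hkC : ∀ x, 0 < x → s (N x) ≤ C x := by
    intro x hx
    have hφ1 := hφ_nonneg x hx.le
    have hφ2 := hφ_nonneg x⁻¹ (inv_pos.2 hx).le
    show s ⌈max x x⁻¹⌉₊ ≤ φ x + φ x⁻¹
    rcases le_total x x⁻¹ with h | h
    · rw [max_eq_right h]
      linarith [hφ_ge x⁻¹ (inv_pos.2 hx).le]
    · rw [max_eq_left h]
      linarith [hφ_ge x hx.le]
  have hpos : ∀ x, 0 < x → 0 < weilGroundEnergy x :=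
    fun x hx ↦ weilGroundEnergy_pos_of_diniLeakage hD hW hx
  refine ⟨C, fun b a hb hba ↦ ⟨?_, ?_⟩⟩
  · refine (hC_cont.mono ?_).intervalIntegrable
    rw [uIcc_of_le hba]
    exact fun t ht ↦ lt_of_lt_of_le hb ht.1
  · have hcont : ContinuousOn weilGroundEnergy (Icc b a) :=
      fun y hy ↦ (hW y (lt_of_lt_of_le hb hy.1)).continuousWithinAt
    refine dini_fence (k := fun x ↦ s (N x)) hb hba hcont (hpos b hb) hC_cont
      (fun x hx ↦ hkC x (lt_of_lt_of_le hb hx.1)) ?_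
    intro x hx η δ hη hδ
    have hx0 : 0 < x := lt_of_lt_of_le hb hx.1
    obtain ⟨h, hh, hhδ, hle⟩ := hK (N x) x (hN1 x hx0) (hN2 x hx0) η δ hη hδ
    refine ⟨h, hh, hhδ, hle.trans ?_⟩
    have h1 : K (N x) * weilGroundEnergy x ≤ s (N x) * weilGroundEnergy x :=
      mul_le_mul_of_nonneg_right (hKs _) (hpos x hx0).le
    exact mul_le_mul_of_nonneg_left (by linarith) hh.le

end Summit.RiemannHypothesis.RiemannHypothesis.Theorems.WeilWindowFlowDiniGlue

end
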